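import Mathlib
import Summits.KontsevichZagierPeriods.KontsevichZagierPeriods.Theorems.SoloInformedRealSpanCancellation
import Summits.KontsevichZagierPeriods.KontsevichZagierPeriods.Theorems.SoloInformedRealAdicCancellation
import Literature.NumberTheory.Transcendental.DerivationExtension
import Literature.NumberTheory.Transcendental.RosenlichtDifferentials
import Literature.NumberTheory.Transcendental.LindemannWeierstrassProofs
import HarnessLib

/-!
# `y_π` has `𝔪`-adic order exactly one on the `ℚ`-span sector `ℝ·P_ℚ ⊆ P_ℝ`

File of the solo-informed residency (s238), sequel of `SoloInformedRealSpanCancellation` (the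
`ℚ`-data line `ι : KZ.FormalRep →+ P_ℝ`, the real span `A := ℝ·P_ℚ = soloInformedRatSpanReal`,
THEOREM T⊗ `soloInformed_ratSpan_linIndep_eq_zero_iff_prep`) and of
`SoloInformedRealAdicCancellation` (the value ideal `𝔪 = ker ev = soloInformedRealValIdeal` of the
commutative `ℝ`-algebra `P_ℝ`, the defect `y_u = u − ev(u) · 1 = soloInformedRealDefect u`, and the
question whether the `𝔪`-adic jets `P_ℝ ⧸ 𝔪ʲ` separate `P_ℝ`, which would prove the cancellation
conjunct (2) of Kontsevich–Zagier's Conjecture 1).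

**The mechanism: derivations of `ℝ` pass to `ℝ·P_ℚ`.**  Let `k = algebraicClosure ℚ ℝ` and let
`D : Derivation ℚ ℝ ℝ` be a `ℚ`-derivation of the field `ℝ` (these exist in abundance:
`exists_derivation_of_algebraicIndependent`, `exists_derivation_eq_one_of_transcendental`; they
kill `k`, `Rosenlicht.derivation_eq_zero_of_isAlgebraic`).  For a presentation `(s, q)` of an
element `∑ᵢ sᵢ • ι(qᵢ)` of `A` — real scalars `sᵢ`, `ℚ`-data `qᵢ` — put
`Φ_D(s, q) := ∑ᵢ D(sᵢ) · ev(qᵢ)` (`soloInformedDerivVal`).  Granting the Lion–Rolin preparation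
fact (`semialgebraicPreparation`, as everywhere on the real side of the residency):

* `soloInformed_derivVal_eq_zero_of_sum_eq_zero_prep` — **`Φ_D` is well defined on `A`**: if
  `∑ᵢ sᵢ • ι(qᵢ) = 0` in `P_ℝ` then `Φ_D(s, q) = 0`.  Proof: write `sᵢ = ∑ⱼ aᵢⱼ cⱼ` with `aᵢⱼ ∈ k`
  and `c` linearly independent over `k` (`soloInformed_exists_algCoord`), fold the algebraic
  coordinates into the data, `Qⱼ = ∑ᵢ aᵢⱼ • qᵢ`; THEOREM T⊗ gives `Qⱼ ∈ KZ.relations`, so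
  `∑ᵢ aᵢⱼ ev(qᵢ) = ev(Qⱼ) = 0` for every `j`, while `D(aᵢⱼ) = 0`; hence
  `Φ_D(s, q) = ∑ⱼ D(cⱼ) ∑ᵢ aᵢⱼ ev(qᵢ) = 0`.  (Abstractly `Φ_D = D ⊗ₖ ev` on `A ≅ ℝ ⊗ₖ P_k`.)
* `soloInformed_derivVal_mul` — **Leibniz**: `Φ_D(x y) = ev(x) Φ_D(y) + Φ_D(x) ev(y)` on product
  presentations; hence `soloInformed_derivVal_eq_zero_of_eq_sum_mul_prep` — **`Φ_D` kills
  `𝔪_A² := {∑ⱼ aⱼ bⱼ : aⱼ, bⱼ ∈ A, ev aⱼ = ev bⱼ = 0}`**, the square of the value ideal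
  `𝔪_A = A ∩ 𝔪` of the subring `A` (`A` is a subring: `soloInformed_one_mem_ratSpanReal`,
  `soloInformed_mul_mem_ratSpanReal`).
* `soloInformed_derivVal_realDefect` — on the defects `y_q = ι(q) − ev(q) · 1` of `ℚ`-data,
  `Φ_D(∑ₗ wₗ • y_{qₗ}) = −∑ₗ wₗ D(ev qₗ)`.

**THEOREM (cotangent independence on the `ℚ`-span sector)**
`soloInformed_realDefect_linIndep_mod_sq_prep` (prep): if `ℚ`-data `q₁, …, qₙ` have values
`ev(q₁), …, ev(qₙ)` ALGEBRAICALLY INDEPENDENT over `ℚ`, then the defects `y_{q₁}, …, y_{qₙ} ∈ 𝔪_A`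
are `ℝ`-linearly independent modulo `𝔪_A²`: `∑ₗ wₗ • y_{qₗ} ∈ 𝔪_A² → ∀ l, wₗ = 0` (choose `D`
with `D(ev qₗ) = δₗₘ`).  In particular (`n = 1`, Lindemann's `transcendental_pi_holds`):

**THEOREM (`𝔪`-adic order one)** `soloInformed_realDefect_ne_sum_mul_prep`,
`soloInformed_piDefect_ne_sum_mul_prep` (prep): for every `ℚ`-datum `q` of transcendental value —
e.g. `y_π = ⟦π⟧ − π · 1`, `q = [D̄, 1]` — the defect `y_q` lies in `𝔪_A` (indeed in `A ∩ 𝔪`,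
`soloInformed_realDefect_ratToReal_mem`) but NOT in `𝔪_A²`: it is not a finite sum `∑ⱼ aⱼ bⱼ`
with `aⱼ, bⱼ ∈ ℝ·P_ℚ` of value `0`.  So the first jet `A ⧸ 𝔪_A²` already sees `y_π`, and the
cotangent space `𝔪_A ⧸ 𝔪_A²` of `ℝ·P_ℚ` at the augmentation `ev` has `ℝ`-dimension at least the
transcendence degree of the field generated by the periods — unconditionally in Conjecture 1
(granting only the preparation fact), the shadow of `d(ev q) ≠ 0` in `Ω_{ℝ/ℚ}`.

Reading (kernel form of the last clause of `paper/real-parameters.md` (S3), "the `y_π`-adic order"):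
on the sector `ℝ·P_ℚ` the `𝔪`-adic filtration is NOT degenerate at order one/two, in contrast with the
unconditional divisibility phenomena of `SoloInformedRealAdicCancellation` for torsion.  Scope, stated
plainly: `Φ_D` is defined on `ℝ·P_ℚ` only; nothing here controls `𝔪²` of the whole ring `P_ℝ`
(products with genuinely real data), and nothing here bears on `Q_ℝ` or on `KZ.PiCancellation`,
which remain OPEN.

References: M. Kontsevich, D. Zagier, *Periods* (2001), §1.2, §4.1; M. Rosenlicht, *On Liouville's
theory of elementary functions*, Pacific J. Math. 65 (1976), Prop. 3 (derivations and algebraic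
dependence); F. Lindemann (1882), transcendence of `π`.
-/

noncomputable section

open Set MeasureTheory
open Literature.ModelTheory.ExponentialFields Literature.NumberTheory.Transcendental KZ

namespace Summit.KontsevichZagierPeriods.KontsevichZagierPeriods.Theorems

/-! ### The `ℚ`-data line is multiplicative; values of presentations -/

/-- `ev(ι c) = KZ.eval c`: the value of a `ℚ`-datum read in `P_ℝ`. -/
theorem soloInformed_evalPOver_ratToReal (c : KZ.FormalRep) :
    soloInformedEvalPOver ℝ (soloInformedRatToReal c) = KZ.eval c := by
  rw [soloInformed_ratToReal_apply, soloInformed_evalPOver_toPeriodOver, KZOver.eval_baseChange,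
    KZOver.eval_equivKZ]

/-- **`ι` is multiplicative**: `ι(c c') = ι(c) ι(c')` (base change and `equivKZ` are). -/
theorem soloInformed_ratToReal_mul (c c' : KZ.FormalRep) :
    soloInformedRatToReal (c * c') = soloInformedRatToReal c * soloInformedRatToReal c' := by
  rw [soloInformed_ratToReal_apply, soloInformed_ratToReal_apply, soloInformed_ratToReal_apply,
    soloInformed_equivKZ_mul, soloInformed_baseChangeOver_mul, map_mul]

/-- **`ι [pt, 1] = 1`**: the unit of `P_ℝ` lies on the `ℚ`-data line. -/
theorem soloInformed_ratToReal_unitOver :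
    soloInformedRatToReal (KZOver.equivKZ.symm (KZOver.of (soloInformedUnitOver (k := ℚ)))) = 1 := by
  rw [soloInformed_ratToReal_apply, AddEquiv.apply_symm_apply, KZOver.baseChange_of]
  have h : (soloInformedUnitOver (k := ℚ)).baseChange ℝ = soloInformedUnitOver :=
    KZOver.IntegralRep.ext rfl rfl
  rw [h]
  exact soloInformed_toPeriodOver_of_unitOver ℝ

/-- `KZ.eval [pt, 1] = 1`. -/
theorem soloInformed_eval_unitOver_rat :
    KZ.eval (KZOver.equivKZ.symm (KZOver.of (soloInformedUnitOver (k := ℚ)))) = 1 := by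
  rw [← soloInformed_evalPOver_ratToReal, soloInformed_ratToReal_unitOver, map_one]

/-- `1 ∈ ℝ·P_ℚ`. -/
theorem soloInformed_one_mem_ratSpanReal :
    (1 : SoloInformedPeriodRingOver ℝ) ∈ soloInformedRatSpanReal := by
  rw [← soloInformed_ratToReal_unitOver]
  exact soloInformed_ratToReal_mem_ratSpanReal _

/-- **Product of presentations**: `(∑ᵢ sᵢ • ι qᵢ)(∑ₗ tₗ • ι pₗ) = ∑₍ᵢ,ₗ₎ (sᵢ tₗ) • ι(qᵢ pₗ)`. -/
theorem soloInformed_sum_smul_ratToReal_mul_sum {ι κ : Type*} [Fintype ι] [Fintype κ]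
    (s : ι → ℝ) (q : ι → KZ.FormalRep) (t : κ → ℝ) (p : κ → KZ.FormalRep) :
    (∑ i, s i • soloInformedRatToReal (q i)) * ∑ l, t l • soloInformedRatToReal (p l) =
      ∑ il : ι × κ, (s il.1 * t il.2) • soloInformedRatToReal (q il.1 * p il.2) := by
  rw [Finset.sum_mul_sum, Fintype.sum_prod_type]
  exact Finset.sum_congr rfl fun i _ => Finset.sum_congr rfl fun l _ => by
    rw [smul_mul_smul_comm, soloInformed_ratToReal_mul]

/-- **`ℝ·P_ℚ` is closed under products** (with `soloInformed_one_mem_ratSpanReal`: a subring of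
`P_ℝ`, so that `A ∩ 𝔪` is an ideal of it and `𝔪_A² = {∑ⱼ aⱼ bⱼ}`). -/
theorem soloInformed_mul_mem_ratSpanReal {x y : SoloInformedPeriodRingOver ℝ}
    (hx : x ∈ soloInformedRatSpanReal) (hy : y ∈ soloInformedRatSpanReal) :
    x * y ∈ soloInformedRatSpanReal := by
  obtain ⟨M, s, q, rfl⟩ := (soloInformed_mem_ratSpanReal_iff x).1 hx
  obtain ⟨M', t, p, rfl⟩ := (soloInformed_mem_ratSpanReal_iff _).1 hy
  rw [soloInformed_sum_smul_ratToReal_mul_sum]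
  exact soloInformed_sum_smul_ratToReal_mem_ratSpanReal _ _

/-- **Value of a presentation**: `ev(∑ᵢ sᵢ • ι qᵢ) = ∑ᵢ sᵢ ev(qᵢ)`. -/
theorem soloInformed_evalPOver_sum_smul_ratToReal {ι : Type*} [Fintype ι] (s : ι → ℝ)
    (q : ι → KZ.FormalRep) :
    soloInformedEvalPOver ℝ (∑ i, s i • soloInformedRatToReal (q i)) =
      ∑ i, s i * KZ.eval (q i) := by
  rw [map_sum]
  exact Finset.sum_congr rfl fun i _ => by
    rw [soloInformed_evalPOver_real_smul, soloInformed_evalPOver_ratToReal]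

/-! ### Algebraic coordinates of real scalars -/

/-- **Algebraic coordinates.** A finite family of reals `s` is `sᵢ = ∑ⱼ aᵢⱼ cⱼ` with every
`aᵢⱼ` real algebraic and `c` linearly independent over the field `k = algebraicClosure ℚ ℝ` of
real algebraic numbers (a `k`-basis of `span_k {sᵢ}`).  Unconditional. -/
theorem soloInformed_exists_algCoord {ι : Type*} [Fintype ι] (s : ι → ℝ) :
    ∃ (N : ℕ) (c : Fin N → ℝ) (a : ι → Fin N → ℝ),
      LinearIndependent (algebraicClosure ℚ ℝ) c ∧ (∀ i j, IsAlgebraic ℚ (a i j)) ∧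
        ∀ i, s i = ∑ j, a i j * c j := by
  classical
  let V : Submodule (algebraicClosure ℚ ℝ) ℝ :=
    Submodule.span (algebraicClosure ℚ ℝ) (Set.range s)
  haveI : FiniteDimensional (algebraicClosure ℚ ℝ) V :=
    FiniteDimensional.span_of_finite (algebraicClosure ℚ ℝ) (Set.finite_range s)
  let B := Module.finBasis (algebraicClosure ℚ ℝ) V
  have hmem : ∀ i, s i ∈ V := fun i => Submodule.subset_span ⟨i, rfl⟩
  refine ⟨Module.finrank (algebraicClosure ℚ ℝ) V, fun j => ((B j : V) : ℝ),
    fun i j => ((B.repr ⟨s i, hmem i⟩ j : algebraicClosure ℚ ℝ) : ℝ), ?_,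
    fun i j => mem_algebraicClosure_iff.1 (B.repr ⟨s i, hmem i⟩ j).2, fun i => ?_⟩
  · simpa [Function.comp_def] using B.linearIndependent.map' V.subtype V.ker_subtype
  · have h := congrArg V.subtype (B.sum_repr ⟨s i, hmem i⟩)
    rw [map_sum] at h
    simp only [map_smul, Submodule.subtype_apply, IntermediateField.smul_def, smul_eq_mul] at h
    exact h.symm

/-- **Folding algebraic coordinates into the data**: with `sᵢ = ∑ⱼ aᵢⱼ cⱼ`, `aᵢⱼ` algebraic,
`∑ᵢ sᵢ • ι(qᵢ) = ∑ⱼ cⱼ • ι(Qⱼ)` for the `ℚ`-data `Qⱼ = ∑ᵢ aᵢⱼ • qᵢ`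
(`soloInformed_smul_ratToReal_of_isAlgebraic`). -/
theorem soloInformed_sum_smul_ratToReal_algCoord {ι : Type*} [Fintype ι] {N : ℕ} {s : ι → ℝ}
    {c : Fin N → ℝ} {a : ι → Fin N → ℝ} (ha : ∀ i j, IsAlgebraic ℚ (a i j))
    (hs : ∀ i, s i = ∑ j, a i j * c j) (q : ι → KZ.FormalRep) :
    ∑ i, s i • soloInformedRatToReal (q i) =
      ∑ j, c j • soloInformedRatToReal
        (∑ i, KZOver.equivKZ.symm (soloInformedAlgScale (ha i j) (KZOver.equivKZ (q i)))) :=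
  calc ∑ i, s i • soloInformedRatToReal (q i)
      = ∑ i, ∑ j, (a i j * c j) • soloInformedRatToReal (q i) :=
        Finset.sum_congr rfl fun i _ => by rw [← Finset.sum_smul, ← hs i]
    _ = ∑ j, ∑ i, c j • (a i j • soloInformedRatToReal (q i)) := by
        rw [Finset.sum_comm]
        exact Finset.sum_congr rfl fun j _ => Finset.sum_congr rfl fun i _ => by
          rw [mul_comm, mul_smul]
    _ = _ := Finset.sum_congr rfl fun j _ => by
        rw [← Finset.smul_sum, map_sum]
        exact congrArg _ (Finset.sum_congr rfl fun i _ =>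
          soloInformed_smul_ratToReal_of_isAlgebraic (ha i j) (q i))

/-- The value of the folded datum: `ev(Qⱼ) = ∑ᵢ aᵢⱼ ev(qᵢ)`. -/
theorem soloInformed_eval_algCoordData {ι : Type*} [Fintype ι] {N : ℕ} {a : ι → Fin N → ℝ}
    (ha : ∀ i j, IsAlgebraic ℚ (a i j)) (q : ι → KZ.FormalRep) (j : Fin N) :
    soloInformedEvalPOver ℝ (soloInformedRatToReal
        (∑ i, KZOver.equivKZ.symm (soloInformedAlgScale (ha i j) (KZOver.equivKZ (q i))))) =
      ∑ i, a i j * KZ.eval (q i) := by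
  rw [map_sum, map_sum]
  exact Finset.sum_congr rfl fun i _ => by
    rw [← soloInformed_smul_ratToReal_of_isAlgebraic (ha i j) (q i),
      soloInformed_evalPOver_real_smul, soloInformed_evalPOver_ratToReal]

/-! ### The functional `Φ_D = D ⊗ ev` on presentations -/

/-- **The `D`-value of a presentation.**  For a `ℚ`-derivation `D` of `ℝ` and a presentation
`(s, q)` — real scalars `sᵢ`, `ℚ`-data `qᵢ` — of the element `∑ᵢ sᵢ • ι(qᵢ)` of `ℝ·P_ℚ`:
`Φ_D(s, q) := ∑ᵢ D(sᵢ) · ev(qᵢ)`. -/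
def soloInformedDerivVal (D : Derivation ℚ ℝ ℝ) {ι : Type*} [Fintype ι] (s : ι → ℝ)
    (q : ι → KZ.FormalRep) : ℝ :=
  ∑ i, D (s i) * KZ.eval (q i)

/-- **`Φ_D` is well defined on `ℝ·P_ℚ`** (prep): a presentation of `0` has `D`-value `0`.
THEOREM T⊗ + algebraic coordinates + "`D` kills real algebraic numbers".
[cite: KontsevichZagier2001, §1.2] -/
theorem soloInformed_derivVal_eq_zero_of_sum_eq_zero_prep (hprep : semialgebraicPreparation)
    (D : Derivation ℚ ℝ ℝ) {ι : Type*} [Fintype ι] {s : ι → ℝ} {q : ι → KZ.FormalRep}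
    (h : ∑ i, s i • soloInformedRatToReal (q i) = 0) : soloInformedDerivVal D s q = 0 := by
  obtain ⟨N, c, a, hc, ha, hs⟩ := soloInformed_exists_algCoord s
  rw [soloInformed_sum_smul_ratToReal_algCoord ha hs q,
    soloInformed_ratSpan_linIndep_eq_zero_iff_prep hprep hc] at h
  have hQ : ∀ j, ∑ i, a i j * KZ.eval (q i) = 0 := fun j => by
    rw [← soloInformed_eval_algCoordData ha q j,
      (soloInformed_ratToReal_eq_zero_iff_prep hprep _).2 (h j), map_zero]
  have hD : ∀ i j, D (a i j) = 0 := fun i j =>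
    Rosenlicht.derivation_eq_zero_of_isAlgebraic D (ha i j)
  unfold soloInformedDerivVal
  calc ∑ i, D (s i) * KZ.eval (q i)
      = ∑ i, ∑ j, D (c j) * (a i j * KZ.eval (q i)) := Finset.sum_congr rfl fun i _ => by
        rw [hs i, map_sum, Finset.sum_mul]
        exact Finset.sum_congr rfl fun j _ => by
          rw [Derivation.leibniz, hD i j, smul_zero, add_zero, smul_eq_mul]
          ring
    _ = ∑ j, D (c j) * ∑ i, a i j * KZ.eval (q i) := by
        rw [Finset.sum_comm]
        exact Finset.sum_congr rfl fun j _ => by rw [Finset.mul_sum]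
    _ = 0 := Finset.sum_eq_zero fun j _ => by rw [hQ j, mul_zero]

/-- **Two presentations of one element have the same `D`-value** (prep). -/
theorem soloInformed_derivVal_eq_of_sum_eq_prep (hprep : semialgebraicPreparation)
    (D : Derivation ℚ ℝ ℝ) {ι κ : Type*} [Fintype ι] [Fintype κ] {s : ι → ℝ}
    {q : ι → KZ.FormalRep} {t : κ → ℝ} {p : κ → KZ.FormalRep}
    (h : ∑ i, s i • soloInformedRatToReal (q i) = ∑ l, t l • soloInformedRatToReal (p l)) :
    soloInformedDerivVal D s q = soloInformedDerivVal D t p := by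
  have h0 : ∑ v : ι ⊕ κ, Sum.elim s (fun l => -t l) v •
      soloInformedRatToReal (Sum.elim q p v) = 0 := by
    rw [Fintype.sum_sum_type]
    simp only [Sum.elim_inl, Sum.elim_inr, neg_smul, Finset.sum_neg_distrib]
    rw [h, add_neg_cancel]
  have h1 := soloInformed_derivVal_eq_zero_of_sum_eq_zero_prep hprep D h0
  unfold soloInformedDerivVal at h1 ⊢
  rw [Fintype.sum_sum_type] at h1
  simp only [Sum.elim_inl, Sum.elim_inr, map_neg, neg_mul, Finset.sum_neg_distrib] at h1
  exact add_neg_eq_zero.1 h1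

/-- **Leibniz rule for `Φ_D` on product presentations**:
`Φ_D(x y) = ev(x) Φ_D(y) + Φ_D(x) ev(y)` (Fubini: `ev` is multiplicative). -/
theorem soloInformed_derivVal_mul (D : Derivation ℚ ℝ ℝ) {ι κ : Type*} [Fintype ι] [Fintype κ]
    (s : ι → ℝ) (q : ι → KZ.FormalRep) (t : κ → ℝ) (p : κ → KZ.FormalRep) :
    soloInformedDerivVal D (fun il : ι × κ => s il.1 * t il.2) (fun il => q il.1 * p il.2) =
      (∑ i, s i * KZ.eval (q i)) * soloInformedDerivVal D t p +
        soloInformedDerivVal D s q * ∑ l, t l * KZ.eval (p l) := by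
  unfold soloInformedDerivVal
  rw [Fintype.sum_prod_type, Finset.sum_mul_sum, Finset.sum_mul_sum, ← Finset.sum_add_distrib]
  exact Finset.sum_congr rfl fun i _ => by
    rw [← Finset.sum_add_distrib]
    exact Finset.sum_congr rfl fun l _ => by
      rw [Derivation.leibniz, KZ.eval_mul KZ.prodFunSemialgebraic_holds, smul_eq_mul, smul_eq_mul]
      ring

/-- **`Φ_D` kills `𝔪_A²`** (prep): if an element of `ℝ·P_ℚ` with presentation `(σ, ρ)` is a
finite sum of products `aⱼ bⱼ` of elements of `ℝ·P_ℚ` of value `0`, then `Φ_D(σ, ρ) = 0`.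
[cite: KontsevichZagier2001, §4.1] -/
theorem soloInformed_derivVal_eq_zero_of_eq_sum_mul_prep (hprep : semialgebraicPreparation)
    (D : Derivation ℚ ℝ ℝ) {S : Type*} [Fintype S] {σ : S → ℝ} {ρ : S → KZ.FormalRep}
    {J : Type*} [Fintype J] {a b : J → SoloInformedPeriodRingOver ℝ}
    (ha : ∀ j, a j ∈ soloInformedRatSpanReal) (hb : ∀ j, b j ∈ soloInformedRatSpanReal)
    (ha₀ : ∀ j, soloInformedEvalPOver ℝ (a j) = 0) (hb₀ : ∀ j, soloInformedEvalPOver ℝ (b j) = 0)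
    (h : ∑ u, σ u • soloInformedRatToReal (ρ u) = ∑ j, a j * b j) :
    soloInformedDerivVal D σ ρ = 0 := by
  choose M s q hs using fun j => (soloInformed_mem_ratSpanReal_iff (a j)).1 (ha j)
  choose M' t p ht using fun j => (soloInformed_mem_ratSpanReal_iff (b j)).1 (hb j)
  have hprod : ∑ j, a j * b j =
      ∑ v : (Σ j, Fin (M j) × Fin (M' j)), (s v.1 v.2.1 * t v.1 v.2.2) •
        soloInformedRatToReal (q v.1 v.2.1 * p v.1 v.2.2) := by
    rw [Fintype.sum_sigma]
    exact Finset.sum_congr rfl fun j _ => by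
      rw [hs j, ht j]
      exact soloInformed_sum_smul_ratToReal_mul_sum (s j) (q j) (t j) (p j)
  rw [hprod] at h
  rw [soloInformed_derivVal_eq_of_sum_eq_prep hprep D h]
  unfold soloInformedDerivVal
  rw [Fintype.sum_sigma]
  refine Finset.sum_eq_zero fun j _ => ?_
  have hva : ∑ i, s j i * KZ.eval (q j i) = 0 := by
    rw [← soloInformed_evalPOver_sum_smul_ratToReal, ← hs j]; exact ha₀ j
  have hvb : ∑ l, t j l * KZ.eval (p j l) = 0 := by
    rw [← soloInformed_evalPOver_sum_smul_ratToReal, ← ht j]; exact hb₀ j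
  have hj := soloInformed_derivVal_mul D (s j) (q j) (t j) (p j)
  rw [hva, hvb, zero_mul, mul_zero, add_zero] at hj
  exact hj

/-! ### Defects of `ℚ`-data and their `D`-values -/

/-- **`y_q ∈ ℝ·P_ℚ ∩ 𝔪`**: the defect of a `ℚ`-datum lies in the value ideal of the subring. -/
theorem soloInformed_realDefect_ratToReal_mem (q : KZ.FormalRep) :
    soloInformedRealDefect (soloInformedRatToReal q) ∈ soloInformedRatSpanReal ∧
      soloInformedRealDefect (soloInformedRatToReal q) ∈ soloInformedRealValIdeal := by
  refine ⟨?_, soloInformed_realDefect_mem _⟩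
  rw [soloInformedRealDefect, Algebra.algebraMap_eq_smul_one]
  exact Submodule.sub_mem _ (soloInformed_ratToReal_mem_ratSpanReal q)
    (Submodule.smul_mem _ _ soloInformed_one_mem_ratSpanReal)

/-- **Presentation of a combination of defects** on the `ℚ`-data line:
`∑ₗ wₗ • y_{qₗ} = ∑ₗ wₗ • ι(qₗ) + ∑ₗ (−wₗ ev qₗ) • ι([pt, 1])`. -/
theorem soloInformed_sum_smul_realDefect_ratToReal {L : Type*} [Fintype L] (w : L → ℝ)
    (q : L → KZ.FormalRep) :
    ∑ l, w l • soloInformedRealDefect (soloInformedRatToReal (q l)) =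
      ∑ v : L ⊕ L, Sum.elim w (fun l => -(w l * KZ.eval (q l))) v •
        soloInformedRatToReal (Sum.elim q
          (fun _ => KZOver.equivKZ.symm (KZOver.of (soloInformedUnitOver (k := ℚ)))) v) := by
  rw [Fintype.sum_sum_type, ← Finset.sum_add_distrib]
  exact Finset.sum_congr rfl fun l _ => by
    simp only [Sum.elim_inl, Sum.elim_inr]
    rw [soloInformed_ratToReal_unitOver, soloInformedRealDefect, soloInformed_evalPOver_ratToReal,
      Algebra.algebraMap_eq_smul_one, smul_sub, smul_smul, neg_smul, sub_eq_add_neg]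

/-- **`D`-value of a combination of defects**: `Φ_D(∑ₗ wₗ • y_{qₗ}) = −∑ₗ wₗ D(ev qₗ)`. -/
theorem soloInformed_derivVal_realDefect (D : Derivation ℚ ℝ ℝ) {L : Type*} [Fintype L]
    (w : L → ℝ) (q : L → KZ.FormalRep) :
    soloInformedDerivVal D (Sum.elim w (fun l => -(w l * KZ.eval (q l))))
        (Sum.elim q (fun _ => KZOver.equivKZ.symm (KZOver.of (soloInformedUnitOver (k := ℚ))))) =
      -∑ l, w l * D (KZ.eval (q l)) := by
  unfold soloInformedDerivVal
  rw [Fintype.sum_sum_type, ← Finset.sum_neg_distrib, ← Finset.sum_add_distrib]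
  exact Finset.sum_congr rfl fun l _ => by
    simp only [Sum.elim_inl, Sum.elim_inr]
    rw [soloInformed_eval_unitOver_rat, map_neg, Derivation.leibniz, smul_eq_mul, smul_eq_mul]
    ring

/-! ### THEOREM: cotangent independence and `𝔪`-adic order one on `ℝ·P_ℚ` -/

/-- **THEOREM (cotangent independence on the `ℚ`-span sector)** (prep).  If the values
`ev(qₗ)` of the `ℚ`-data `qₗ` are algebraically independent over `ℚ`, then the defects
`y_{qₗ} = ι(qₗ) − ev(qₗ) · 1` are `ℝ`-linearly independent modulo `𝔪_A²`: a real combination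
`∑ₗ wₗ • y_{qₗ}` which is a finite sum of products `aⱼ bⱼ`, `aⱼ, bⱼ ∈ ℝ·P_ℚ` of value `0`, has all
`wₗ = 0`.  Proof: apply `Φ_D` with `D(ev qₗ) = δₗₘ` (`exists_derivation_of_algebraicIndependent`).
[cite: KontsevichZagier2001, §4.1] -/
theorem soloInformed_realDefect_linIndep_mod_sq_prep (hprep : semialgebraicPreparation)
    {L : Type*} [Fintype L] {q : L → KZ.FormalRep}
    (hq : AlgebraicIndependent ℚ fun l => KZ.eval (q l)) {w : L → ℝ}
    {J : Type*} [Fintype J] {a b : J → SoloInformedPeriodRingOver ℝ}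
    (ha : ∀ j, a j ∈ soloInformedRatSpanReal) (hb : ∀ j, b j ∈ soloInformedRatSpanReal)
    (ha₀ : ∀ j, soloInformedEvalPOver ℝ (a j) = 0) (hb₀ : ∀ j, soloInformedEvalPOver ℝ (b j) = 0)
    (h : ∑ l, w l • soloInformedRealDefect (soloInformedRatToReal (q l)) = ∑ j, a j * b j) :
    ∀ l, w l = 0 := by
  classical
  intro m
  obtain ⟨D, hD⟩ :=
    exists_derivation_of_algebraicIndependent hq fun l => if l = m then (1 : ℝ) else 0
  rw [soloInformed_sum_smul_realDefect_ratToReal] at h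
  have h0 := soloInformed_derivVal_eq_zero_of_eq_sum_mul_prep hprep D ha hb ha₀ hb₀ h
  rw [soloInformed_derivVal_realDefect, neg_eq_zero] at h0
  simp only [hD, mul_ite, mul_one, mul_zero, Finset.sum_ite_eq', Finset.mem_univ, if_true] at h0
  exact h0

/-- **THEOREM (`𝔪`-adic order one on the `ℚ`-span sector)** (prep).  The defect
`y_q = ι(q) − ev(q) · 1` of a `ℚ`-datum `q` of TRANSCENDENTAL value is not in `𝔪_A²`: it is not a
finite sum `∑ⱼ aⱼ bⱼ` with `aⱼ, bⱼ ∈ ℝ·P_ℚ` of value `0` (while `y_q ∈ ℝ·P_ℚ ∩ 𝔪`,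
`soloInformed_realDefect_ratToReal_mem`).  [cite: KontsevichZagier2001, §4.1] -/
theorem soloInformed_realDefect_ne_sum_mul_prep (hprep : semialgebraicPreparation)
    {q₀ : KZ.FormalRep} (hq₀ : Transcendental ℚ (KZ.eval q₀))
    {J : Type*} [Fintype J] {a b : J → SoloInformedPeriodRingOver ℝ}
    (ha : ∀ j, a j ∈ soloInformedRatSpanReal) (hb : ∀ j, b j ∈ soloInformedRatSpanReal)
    (ha₀ : ∀ j, soloInformedEvalPOver ℝ (a j) = 0) (hb₀ : ∀ j, soloInformedEvalPOver ℝ (b j) = 0) :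
    soloInformedRealDefect (soloInformedRatToReal q₀) ≠ ∑ j, a j * b j := by
  intro h
  have hq : AlgebraicIndependent ℚ fun _ : Unit => KZ.eval q₀ :=
    algebraicIndependent_unique_type_iff.2 hq₀
  have h' : ∑ _l : Unit, (1 : ℝ) • soloInformedRealDefect (soloInformedRatToReal q₀) =
      ∑ j, a j * b j := by
    rw [Fintype.sum_unique, one_smul]; exact h
  exact one_ne_zero (soloInformed_realDefect_linIndep_mod_sq_prep hprep hq ha hb ha₀ hb₀ h' ())

/-- `⟦π⟧ = ι [D̄, 1]`: the real disc class is the `ℚ`-datum `KZ.piRep` read in `P_ℝ`. -/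
theorem soloInformed_ratToReal_piRep :
    soloInformedRatToReal (KZ.of KZ.piRep) = soloInformedPiClassReal := by
  rw [soloInformed_ratToReal_apply, KZOver.equivKZ_of, KZOver.baseChange_of]
  rfl

/-- **`y_π = ⟦π⟧ − π · 1` has `𝔪`-adic order exactly one on `ℝ·P_ℚ`** (prep; Lindemann):
`y_π ∈ ℝ·P_ℚ ∩ 𝔪` is not a finite sum `∑ⱼ aⱼ bⱼ` with `aⱼ, bⱼ ∈ ℝ·P_ℚ` of value `0`.
[cite: KontsevichZagier2001, §4.1] -/
theorem soloInformed_piDefect_ne_sum_mul_prep (hprep : semialgebraicPreparation)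
    {J : Type*} [Fintype J] {a b : J → SoloInformedPeriodRingOver ℝ}
    (ha : ∀ j, a j ∈ soloInformedRatSpanReal) (hb : ∀ j, b j ∈ soloInformedRatSpanReal)
    (ha₀ : ∀ j, soloInformedEvalPOver ℝ (a j) = 0) (hb₀ : ∀ j, soloInformedEvalPOver ℝ (b j) = 0) :
    soloInformedRealDefect soloInformedPiClassReal ≠ ∑ j, a j * b j := by
  rw [← soloInformed_ratToReal_piRep]
  refine soloInformed_realDefect_ne_sum_mul_prep hprep ?_ ha hb ha₀ hb₀
  rw [KZ.eval_of, KZ.piRep_value]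
  exact transcendental_pi_holds

end Summit.KontsevichZagierPeriods.KontsevichZagierPeriods.Theorems

end
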